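import Literature.Analysis.Quadrature.TrapezoidalRulePeriodic
import Literature.Analysis.Toeplitz.OneSidedSeries

/-!
# PROVED second-layer inputs of the free-gas sector witness line (card `free-gas-arc-darroch`)
# for crux K1 = `TcThermcert1.ThermalStiffnessCeilingU8b10_le_1o8` (stmt-Ventures-26381)

Planner `hubbard-floor-idea-rescuer` g5 (lens = rescuer), BN-resc-5.  Companion of the checked skeleton
`Cruxes/ThermalStiffnessCeilingU8b10_le_1o8/FreeGasArcSkeleton.lean` (§3 there lists five elementary input `Prop`s
of the analytic core `EsymmLogTwistInsensitive`).  This file is SORRY-FREE and proves: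

* §A `shiftedTrapezoidShift_holds : ShiftedTrapezoidShift` — the ARC input (a real grid offset `θ/N` moves the
  `N`-point periodic trapezoidal sum of a strip-analytic `2π`-periodic function by at most `4NB/(e^{aN} − 1)`),
  from the tree's Trefethen–Weideman theorem `Literature.Analysis.Quadrature.norm_trapezoidal_sub_integral_le`
  applied to `v` and to its real translate (same strip, same bound, same period integral).
* §B–§D the DARROCH BYPASS: for positive weights the elementary symmetric functions `e_j` are log-concave in the
  two-index form `e_{i−1} e_{j+1} ≤ e_i e_j` (`1 ≤ i ≤ j`, induction on the number of weights), hence EVERY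
  degree `M ≤ n` is the mode of `j ↦ e_j t^j` for some fugacity `t > 0` (`esymm_exists_modeFugacity`), which gives
  the polynomial floor `(n+1) · e_M t^M ≥ ∏ (1 + t xᵢ)` (`prod_one_add_mul_le_card_mul_esymm`) WITHOUT Darroch's
  integer-mean theorem, Newton's inequalities or the intermediate value theorem (the skeleton's `EsymmModeAtMean`,
  `EsymmModeShare`, `IntegerMeanFugacity` are thereby not needed by the assembly).
* §E `offArcGaussianDecay_holds : OffArcGaussianDecay` — the OFF-ARC input, one line per mode.
* §G `esymmW_fourierCoeff` — the CONTOUR FORMULA `∫_{−π}^{π} e^{−iMφ} ∏ᵢ(1 + t xᵢ e^{iφ}) dφ = 2π e_M(x) t^M` at any real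
  fugacity (orthogonality `Literature.Analysis.Toeplitz.integral_exp_int_mul_I`), the starting point of the estimate.
* §H `FreeBandLogStrip` (skeleton v2 §3, verbatim) + `freeBandLogStrip_holds` — the one-line logarithm
  `Log(1 + exp(s + iφ + 2β cos z + 2β cos p₂))` is `2π`-periodic, holomorphic and bounded on the strip `|Im z| < min 1 (π/(24β))`.
* §F fugacity pinning: `(k+1) e_{k+1} ≤ (n−k)·(max weight)·e_k` and `≥ (n−k)·(min weight)·e_k`, so the mode
  fugacity of degree `M` lies in `[M/((n−M+1)·max), (M+1)/((n−M)·min)]` — for the free band this puts the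
  chemical potential inside `[−4 − O(1/β), 4 + O(1/β)]`, where a flux-independent positive fraction of the `L²`
  modes is partially occupied (the off-arc variance `∑ p(1−p) ≥ c L²`).

HONEST FRAMING: these are lemmas about symmetric functions of explicit reals and about periodic analytic functions;
nothing here touches `U = 8`.  Superconductivity in the Hubbard model is NOT proved (or disproved) by any of this.
-/

noncomputable section

open Finset Real MeasureTheory
open scoped BigOperators

namespace Summit.Ventures.CertifiedManyBodySolver.Cruxes.ThermalStiffnessCeilingU8b10_le_1o8.FreeGasArcInputs

/-! ## §A The shifted-grid trapezoid bound (the skeleton's `ShiftedTrapezoidShift`, verbatim) -/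

/-- [skeleton §3, verbatim] For `v` `2π`-periodic, complex-differentiable on the open strip `|Im z| < a` and bounded
there by `B`, the `N`-point grid sum moves by at most `4 N B /(e^{aN} − 1)` under a real grid offset `θ/N`. -/
def ShiftedTrapezoidShift : Prop :=
  ∀ (v : ℂ → ℂ) (a B : ℝ), 0 < a → 0 ≤ B →
    (∀ z : ℂ, v (z + 2 * π) = v z) →
    DifferentiableOn ℂ v {z : ℂ | |z.im| < a} →
    (∀ z : ℂ, |z.im| < a → ‖v z‖ ≤ B) →
    ∀ (N : ℕ), 0 < N → ∀ θ : ℝ,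
      ‖(∑ j ∈ range N, v ((2 * π * (j : ℝ) + θ) / (N : ℝ) : ℝ)) -
          ∑ j ∈ range N, v ((2 * π * (j : ℝ)) / (N : ℝ) : ℝ)‖ ≤ 4 * N * B / (Real.exp (a * N) - 1)

/-- **The arc input holds** (two applications of Trefethen–Weideman Thm 4.2 as formalised in
`Literature.Analysis.Quadrature.norm_trapezoidal_sub_integral_le`: the trapezoidal sums of `v` and of its real
translate `z ↦ v(z + θ/N)` are both within `4πB/(e^{aN} − 1)` of the common period integral). -/
theorem shiftedTrapezoidShift_holds : ShiftedTrapezoidShift := by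
  intro v a B ha _hB hper hd hM N hN θ
  have hN0 : N ≠ 0 := hN.ne'
  have hNc : (N : ℂ) ≠ 0 := by exact_mod_cast hN0
  have hNr : (0 : ℝ) < N := by exact_mod_cast hN
  set T : ℝ := 2 * π with hT
  have hTpos : 0 < T := Real.two_pi_pos
  set c : ℝ := θ / N with hc
  -- the real translate of `v`
  set w : ℂ → ℂ := fun z => v (z + (c : ℂ)) with hw
  have hper' : ∀ z : ℂ, v (z + (T : ℂ)) = v z := fun z => by
    rw [hT]; push_cast; exact hper z
  have hwper : ∀ z : ℂ, w (z + (T : ℂ)) = w z := by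
    intro z
    simp only [hw]
    rw [add_right_comm]
    exact hper' _
  have hwd : DifferentiableOn ℂ w {z : ℂ | |z.im| < a} := by
    have h1 : DifferentiableOn ℂ (v ∘ fun z : ℂ => z + (c : ℂ)) {z : ℂ | |z.im| < a} := by
      refine hd.comp (by fun_prop) ?_
      intro z hz
      simpa using hz
    simpa [hw, Function.comp_def] using h1
  have hwM : ∀ z : ℂ, |z.im| < a → ‖w z‖ ≤ B := by
    intro z hz
    simp only [hw]
    exact hM _ (by simpa using hz)
  have h1 := Literature.Analysis.Quadrature.norm_trapezoidal_sub_integral_le hTpos ha hd hper' hM hN0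
  have h2 := Literature.Analysis.Quadrature.norm_trapezoidal_sub_integral_le hTpos ha hwd hwper hwM hN0
  -- the two period integrals agree (translation invariance of the period integral)
  have hint : ∫ x in (0:ℝ)..T, w x = ∫ x in (0:ℝ)..T, v x := by
    have e1 : (∫ x in (0:ℝ)..T, w x) = ∫ x in (0:ℝ)..T, (fun y : ℝ => v y) (x + c) := by
      apply intervalIntegral.integral_congr
      intro x _
      simp only [hw]
      push_cast
      rfl
    rw [e1, intervalIntegral.integral_comp_add_right (fun y : ℝ => v y) c]
    have hp : Function.Periodic (fun y : ℝ => v y) T := by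
      intro y
      show v ((y + T : ℝ) : ℂ) = v y
      push_cast
      exact hper' y
    have h3 := hp.intervalIntegral_add_eq c 0
    rw [zero_add] at h3
    rw [zero_add, show T + c = c + T by ring]
    exact h3
  -- subtract the two estimates
  have hden : 0 < Real.exp (a * N) - 1 := by
    have : 1 < Real.exp (a * N) := Real.one_lt_exp_iff.mpr (by positivity)
    linarith
  have e1 : Real.exp (2 * π * a * N / T) = Real.exp (a * N) := by
    congr 1
    rw [hT]
    field_simp
  rw [e1] at h1 h2
  have hsub : ‖(T / N : ℂ) * (∑ k ∈ Finset.range N, w (k * T / N) - ∑ k ∈ Finset.range N, v (k * T / N))‖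
      ≤ 2 * T * B / (Real.exp (a * N) - 1) + 2 * T * B / (Real.exp (a * N) - 1) := by
    have : (T / N : ℂ) * (∑ k ∈ Finset.range N, w (k * T / N) - ∑ k ∈ Finset.range N, v (k * T / N))
        = ((T / N : ℂ) * ∑ k ∈ Finset.range N, w (k * T / N) - ∫ x in (0:ℝ)..T, w x)
          - ((T / N : ℂ) * ∑ k ∈ Finset.range N, v (k * T / N) - ∫ x in (0:ℝ)..T, v x) := by
      rw [hint]; ring
    rw [this]
    exact (norm_sub_le _ _).trans (add_le_add h2 h1)
  -- remove the factor `T/N`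
  have hnormTN : ‖(T / N : ℂ)‖ = T / N := by
    rw [show (T / N : ℂ) = ((T / N : ℝ) : ℂ) by push_cast; rfl, Complex.norm_real]
    exact abs_of_pos (div_pos hTpos hNr)
  rw [norm_mul, hnormTN] at hsub
  have hTN : 0 < T / N := div_pos hTpos hNr
  have hsub' : ‖∑ k ∈ Finset.range N, w (k * T / N) - ∑ k ∈ Finset.range N, v (k * T / N)‖
      ≤ 4 * N * B / (Real.exp (a * N) - 1) := by
    have h4 := (le_div_iff₀' hTN).mpr hsub
    refine h4.trans_eq ?_
    field_simp
    ring
  -- identify the nodes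
  have hnode1 : ∑ k ∈ Finset.range N, w (k * T / N) = ∑ j ∈ range N, v ((2 * π * (j : ℝ) + θ) / (N : ℝ) : ℝ) := by
    refine Finset.sum_congr rfl fun k _ => ?_
    simp only [hw, hc, hT]
    congr 1
    push_cast
    field_simp
  have hnode2 : ∑ k ∈ Finset.range N, v (k * T / N) = ∑ j ∈ range N, v ((2 * π * (j : ℝ)) / (N : ℝ) : ℝ) := by
    refine Finset.sum_congr rfl fun k _ => ?_
    simp only [hT]
    congr 1
    push_cast
    ring
  rw [hnode1, hnode2] at hsub'
  exact hsub'

/-! ## §B Elementary symmetric functions of a multiset of reals: recursion, vanishing, mass identity, positivity -/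

/-- `e_0(X) = 1`. -/
theorem esymm_zero_eq_one (X : Multiset ℝ) : X.esymm 0 = 1 := by
  simp [Multiset.esymm, Multiset.powersetCard_zero_left]

/-- The Viète recursion `e_{k+1}(x ∷ X) = e_{k+1}(X) + x·e_k(X)`. -/
theorem esymm_cons_succ (x : ℝ) (X : Multiset ℝ) (k : ℕ) :
    (x ::ₘ X).esymm (k + 1) = X.esymm (k + 1) + x * X.esymm k := by
  rw [Multiset.esymm, Multiset.powersetCard_cons, Multiset.map_add, Multiset.sum_add, Multiset.map_map,
    Multiset.esymm, Multiset.esymm, ← Multiset.sum_map_mul_left]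
  congr 2
  refine Multiset.map_congr rfl fun t _ => ?_
  simp

/-- `e_k(X) = 0` for `k > |X|`. -/
theorem esymm_eq_zero_of_card_lt (X : Multiset ℝ) {k : ℕ} (hk : Multiset.card X < k) : X.esymm k = 0 := by
  rw [Multiset.esymm, Multiset.powersetCard_eq_empty k hk]
  simp

/-- `e_{|X|}(X) = ∏ X`. -/
theorem esymm_card_eq_prod (X : Multiset ℝ) : X.esymm (Multiset.card X) = X.prod := by
  rw [Multiset.esymm, Multiset.powersetCard_self]
  simp

/-- Nonnegative weights have nonnegative elementary symmetric functions. -/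
theorem esymm_nonneg (X : Multiset ℝ) (hX : ∀ a ∈ X, 0 ≤ a) (k : ℕ) : 0 ≤ X.esymm k := by
  rw [Multiset.esymm]
  refine Multiset.sum_nonneg fun b hb => ?_
  rw [Multiset.mem_map] at hb
  obtain ⟨u, hu, rfl⟩ := hb
  refine Multiset.prod_nonneg fun a ha => hX a ?_
  exact Multiset.mem_of_le (Multiset.mem_powersetCard.1 hu).1 ha

/-- Positive weights have positive `e_k` for every `k ≤ |X|`. -/
theorem esymm_pos (X : Multiset ℝ) (hX : ∀ a ∈ X, 0 < a) {k : ℕ} (hk : k ≤ Multiset.card X) :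
    0 < X.esymm k := by
  induction X using Multiset.induction generalizing k with
  | empty =>
    simp only [Multiset.card_zero, Nat.le_zero] at hk
    subst hk
    rw [esymm_zero_eq_one]
    exact one_pos
  | cons x X ih =>
    have hx : 0 < x := hX x (Multiset.mem_cons_self x X)
    have hX' : ∀ a ∈ X, 0 < a := fun a ha => hX a (Multiset.mem_cons_of_mem ha)
    rcases k with _ | k
    · rw [esymm_zero_eq_one]
      exact one_pos
    · rw [Multiset.card_cons] at hk
      rw [esymm_cons_succ]
      have h1 : 0 < X.esymm k := ih hX' (by omega)
      have h2 : 0 ≤ X.esymm (k + 1) := esymm_nonneg X (fun a ha => (hX' a ha).le) _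
      nlinarith [mul_pos hx h1]

/-- **Mass identity** `∑_{j ≤ |X|} e_j(X) t^j = ∏_{a ∈ X} (1 + t·a)` (the grand-canonical partition function of
one free species at fugacity `t`). -/
theorem sum_esymm_mul_pow (X : Multiset ℝ) (t : ℝ) :
    ∑ j ∈ Finset.range (Multiset.card X + 1), X.esymm j * t ^ j = (X.map fun a => 1 + t * a).prod := by
  induction X using Multiset.induction with
  | empty => simp [esymm_zero_eq_one]
  | cons x X ih =>
    set n := Multiset.card X with hn
    set S : ℝ := ∑ j ∈ Finset.range (n + 1), X.esymm j * t ^ j with hS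
    have h0 : X.esymm (n + 1) = 0 := esymm_eq_zero_of_card_lt X (by omega)
    have hS' : ∑ i ∈ Finset.range (n + 1), X.esymm (i + 1) * t ^ (i + 1) + 1 = S := by
      have h := Finset.sum_range_succ' (fun i => X.esymm i * t ^ i) (n + 1)
      rw [Finset.sum_range_succ, h0, zero_mul, add_zero, esymm_zero_eq_one, pow_zero, one_mul] at h
      rw [hS]
      exact h.symm
    rw [Multiset.card_cons, Multiset.map_cons, Multiset.prod_cons, ← ih, Finset.sum_range_succ']
    rw [esymm_zero_eq_one, pow_zero, one_mul]
    have hterm : ∀ i ∈ Finset.range (n + 1),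
        (x ::ₘ X).esymm (i + 1) * t ^ (i + 1) = X.esymm (i + 1) * t ^ (i + 1) + t * x * (X.esymm i * t ^ i) := by
      intro i _
      rw [esymm_cons_succ]
      ring
    rw [Finset.sum_congr rfl hterm, Finset.sum_add_distrib, ← Finset.mul_sum, ← hS]
    linear_combination hS'

/-! ## §C Two-index log-concavity of `e_j` for nonnegative weights -/

/-! Two-index log-concavity of a real sequence `f` means `f(i−1) f(j+1) ≤ f(i) f(j)` for `1 ≤ i ≤ j`
(for positive sequences this is `f(k)² ≥ f(k−1) f(k+1)`, iterated); it is spelled out in each statement. -/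

/-- The Viète step `g(k+1) = f(k+1) + c f(k)` (`c ≥ 0`, `g 0 = f 0`) preserves two-index log-concavity of a
nonnegative sequence. -/
theorem lc2_step {f g : ℕ → ℝ} {c : ℝ} (hf : ∀ k, 0 ≤ f k) (hc : 0 ≤ c)
    (hlc : ∀ i j : ℕ, 1 ≤ i → i ≤ j → f (i - 1) * f (j + 1) ≤ f i * f j)
    (hg0 : g 0 = f 0) (hg : ∀ k, g (k + 1) = f (k + 1) + c * f k) :
    ∀ i j : ℕ, 1 ≤ i → i ≤ j → g (i - 1) * g (j + 1) ≤ g i * g j := by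
  intro i j hi hij
  obtain ⟨j', rfl⟩ : ∃ j', j = j' + 1 := ⟨j - 1, by omega⟩
  rcases Nat.lt_or_ge i 2 with hi1 | hi2
  · -- `i = 1`
    have hi' : i = 1 := by omega
    subst hi'
    have hg1 : g 1 = f 1 + c * f 0 := hg 0
    rw [show (1 : ℕ) - 1 = 0 from rfl, hg0, hg1, hg (j' + 1), hg j']
    have P1 : f 0 * f (j' + 1 + 1) ≤ f 1 * f (j' + 1) := by
      have h := hlc 1 (j' + 1) le_rfl (by omega)
      simpa using h
    nlinarith [mul_nonneg hc (mul_nonneg (hf 1) (hf j')), mul_nonneg (mul_nonneg hc hc) (mul_nonneg (hf 0) (hf j')),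
      mul_nonneg hc (mul_nonneg (hf 0) (hf (j' + 1)))]
  · -- `i = i' + 2`
    obtain ⟨i', rfl⟩ : ∃ i', i = i' + 2 := ⟨i - 2, by omega⟩
    rw [show i' + 2 - 1 = i' + 1 by omega, hg i', hg (j' + 1), hg (i' + 1), hg j']
    have T1 : f (i' + 1) * f (j' + 1 + 1) ≤ f (i' + 2) * f (j' + 1) := by
      have h := hlc (i' + 2) (j' + 1) (by omega) (by omega)
      simpa using h
    have T3a : f i' * f (j' + 1 + 1) ≤ f (i' + 1) * f (j' + 1) := by
      have h := hlc (i' + 1) (j' + 1) (by omega) (by omega)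
      simpa using h
    have T3b : f (i' + 1) * f (j' + 1) ≤ f (i' + 2) * f j' := by
      rcases Nat.lt_or_ge (i' + 1) j' with hlt | hge
      · have h := hlc (i' + 2) j' (by omega) (by omega)
        simpa using h
      · have hj : j' = i' + 1 := by omega
        subst hj
        simp only [mul_comm, le_refl]
    have T4 : f i' * f (j' + 1) ≤ f (i' + 1) * f j' := by
      have h := hlc (i' + 1) j' (by omega) (by omega)
      simpa using h
    have B : c * (f i' * f (j' + 1 + 1)) ≤ c * (f (i' + 2) * f j') :=
      mul_le_mul_of_nonneg_left (T3a.trans T3b) hc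
    have C : c * c * (f i' * f (j' + 1)) ≤ c * c * (f (i' + 1) * f j') :=
      mul_le_mul_of_nonneg_left T4 (mul_nonneg hc hc)
    nlinarith [T1, B, C]

/-- **`e_j` of nonnegative weights is two-index log-concave** (induction on the number of weights via the Viète step;
no Newton inequalities needed). -/
theorem esymm_lc2 (X : Multiset ℝ) (hX : ∀ a ∈ X, 0 ≤ a) :
    ∀ i j : ℕ, 1 ≤ i → i ≤ j → X.esymm (i - 1) * X.esymm (j + 1) ≤ X.esymm i * X.esymm j := by
  induction X using Multiset.induction with
  | empty =>
    intro i j _ _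
    have h1 : (0 : Multiset ℝ).esymm (j + 1) = 0 := esymm_eq_zero_of_card_lt 0 (by simp)
    simp only [h1, mul_zero]
    exact mul_nonneg (esymm_nonneg 0 (by simp) _) (esymm_nonneg 0 (by simp) _)
  | cons x X ih =>
    have hx : 0 ≤ x := hX x (Multiset.mem_cons_self x X)
    have hX' : ∀ a ∈ X, 0 ≤ a := fun a ha => hX a (Multiset.mem_cons_of_mem ha)
    exact lc2_step (f := fun k => X.esymm k) (g := fun k => (x ::ₘ X).esymm k) (fun k => esymm_nonneg X hX' k) hx
      (ih hX') (by simp only [esymm_zero_eq_one]) (fun k => esymm_cons_succ x X k)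

/-! ## §D The mode fugacity (Darroch bypass) and the polynomial floor -/

/-- A nonnegative sequence whose ratios cross `1/t` at `M` (`f j ≤ t f(j+1)` below `M`, `t f(j+1) ≤ f j` from `M` on)
has `j ↦ f(j) t^j` maximal at `M`. -/
theorem mode_of_ratio {f : ℕ → ℝ} {t : ℝ} {M : ℕ} (ht : 0 < t)
    (hdown : ∀ j, j < M → f j ≤ t * f (j + 1)) (hup : ∀ j, M ≤ j → t * f (j + 1) ≤ f j) :
    ∀ j, f j * t ^ j ≤ f M * t ^ M := by
  have up : ∀ d, f (M + d) * t ^ (M + d) ≤ f M * t ^ M := by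
    intro d
    induction d with
    | zero => simp
    | succ d ih =>
      have h := hup (M + d) (by omega)
      calc f (M + (d + 1)) * t ^ (M + (d + 1)) = (t * f (M + d + 1)) * t ^ (M + d) := by
            rw [show M + (d + 1) = M + d + 1 by omega, pow_succ]; ring
        _ ≤ f (M + d) * t ^ (M + d) := mul_le_mul_of_nonneg_right h (pow_nonneg ht.le _)
        _ ≤ _ := ih
  have down : ∀ d, d ≤ M → f (M - d) * t ^ (M - d) ≤ f M * t ^ M := by
    intro d
    induction d with
    | zero => intro _; simp
    | succ d ih =>
      intro hd
      have h := hdown (M - (d + 1)) (by omega)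
      rw [show M - (d + 1) + 1 = M - d by omega] at h
      calc f (M - (d + 1)) * t ^ (M - (d + 1)) ≤ (t * f (M - d)) * t ^ (M - (d + 1)) :=
            mul_le_mul_of_nonneg_right h (pow_nonneg ht.le _)
        _ = f (M - d) * t ^ (M - d) := by
            rw [show M - d = M - (d + 1) + 1 by omega, pow_succ]; ring
        _ ≤ _ := ih (by omega)
  intro j
  rcases Nat.lt_or_ge j M with h | h
  · have h' := down (M - j) (by omega)
    rwa [show M - (M - j) = j by omega] at h'
  · obtain ⟨d, rfl⟩ : ∃ d, j = M + d := ⟨j - M, by omega⟩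
    exact up d

/-- **Mode fugacity (Darroch bypass).** For positive weights and EVERY degree `M ≤ |X|` there is a fugacity `t > 0`
at which `M` is the mode of `j ↦ e_j(X) t^j`.  (Darroch's theorem — integer mean ⇒ mode — is not needed:
log-concavity alone makes every degree an exposed point of the concave sequence `log e_j`.) -/
theorem esymm_exists_modeFugacity (X : Multiset ℝ) (hX : ∀ a ∈ X, 0 < a) {M : ℕ}
    (hM : M ≤ Multiset.card X) :
    ∃ t : ℝ, 0 < t ∧ ∀ j, X.esymm j * t ^ j ≤ X.esymm M * t ^ M := by
  set n := Multiset.card X with hn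
  have hpos : ∀ k, k ≤ n → 0 < X.esymm k := fun k hk => esymm_pos X hX hk
  have hlc := esymm_lc2 X (fun a ha => (hX a ha).le)
  rcases Nat.lt_or_ge M n with hMn | hMn
  · -- `M < n`: `t = e_M / e_{M+1}`
    have hM1 : 0 < X.esymm (M + 1) := hpos (M + 1) hMn
    refine ⟨X.esymm M / X.esymm (M + 1), div_pos (hpos M hMn.le) hM1, ?_⟩
    apply mode_of_ratio (div_pos (hpos M hMn.le) hM1)
    · intro j hj
      have h := hlc (j + 1) M (by omega) (by omega)
      simp only [Nat.add_sub_cancel] at h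
      rw [div_mul_eq_mul_div, le_div_iff₀ hM1]
      linarith [h]
    · intro j hj
      rcases eq_or_lt_of_le hj with rfl | hlt
      · rw [div_mul_cancel₀ _ hM1.ne']
      · have h := hlc (M + 1) j (by omega) (by omega)
        simp only [Nat.add_sub_cancel] at h
        rw [div_mul_eq_mul_div, div_le_iff₀ hM1]
        linarith [h]
  · have hMeq : M = n := le_antisymm hM hMn
    rcases Nat.eq_zero_or_pos n with hn0 | hnpos
    · refine ⟨1, one_pos, fun j => ?_⟩
      rcases Nat.eq_zero_or_pos j with rfl | hj
      · rw [hMeq, hn0]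
      · rw [esymm_eq_zero_of_card_lt X (show Multiset.card X < j by omega), zero_mul]
        exact mul_nonneg (hpos M hM).le (pow_nonneg zero_le_one _)
    · -- `M = n ≥ 1`: `t = e_{n-1} / e_n`
      have hnn : 0 < X.esymm n := hpos n le_rfl
      refine ⟨X.esymm (n - 1) / X.esymm n, div_pos (hpos _ (by omega)) hnn, ?_⟩
      rw [hMeq]
      apply mode_of_ratio (div_pos (hpos _ (by omega)) hnn)
      · intro j hj
        rcases Nat.lt_or_ge (j + 1) n with hlt | hge
        · have h := hlc (j + 1) (n - 1) (by omega) (by omega)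
          rw [Nat.add_sub_cancel, show n - 1 + 1 = n by omega] at h
          rw [div_mul_eq_mul_div, le_div_iff₀ hnn]
          linarith [h]
        · have hj' : j = n - 1 := by omega
          subst hj'
          rw [show n - 1 + 1 = n by omega, div_mul_cancel₀ _ hnn.ne']
      · intro j hj
        rw [esymm_eq_zero_of_card_lt X (show Multiset.card X < j + 1 by omega), mul_zero]
        exact esymm_nonneg X (fun a ha => (hX a ha).le) j

/-- **Polynomial floor at the mode fugacity:** `∏_{a ∈ X} (1 + t a) ≤ (|X| + 1) · e_M(X) t^M`. -/
theorem prod_one_add_mul_le_of_mode (X : Multiset ℝ) {t : ℝ} {M : ℕ}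
    (hmode : ∀ j, X.esymm j * t ^ j ≤ X.esymm M * t ^ M) :
    (X.map fun a => 1 + t * a).prod ≤ ((Multiset.card X : ℝ) + 1) * (X.esymm M * t ^ M) := by
  rw [← sum_esymm_mul_pow]
  calc ∑ j ∈ Finset.range (Multiset.card X + 1), X.esymm j * t ^ j
      ≤ ∑ _j ∈ Finset.range (Multiset.card X + 1), X.esymm M * t ^ M := Finset.sum_le_sum fun j _ => hmode j
    _ = ((Multiset.card X : ℝ) + 1) * (X.esymm M * t ^ M) := by
      rw [Finset.sum_const, Finset.card_range, nsmul_eq_mul]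
      push_cast
      ring

/-! ### The `Fintype`-indexed forms used by the skeleton (`esymmW`, verbatim) -/

/-- [skeleton §2, verbatim] `e_j(x) = ∑_{S ⊆ ι, |S| = j} ∏_{i ∈ S} xᵢ`. -/
def esymmW {ι : Type} [Fintype ι] [DecidableEq ι] (x : ι → ℝ) (j : ℕ) : ℝ :=
  ∑ S ∈ (Finset.univ : Finset ι).powersetCard j, ∏ i ∈ S, x i

theorem esymmW_eq_esymm {ι : Type} [Fintype ι] [DecidableEq ι] (x : ι → ℝ) (j : ℕ) :
    esymmW x j = ((Finset.univ : Finset ι).val.map x).esymm j := by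
  unfold esymmW
  exact (Finset.esymm_map_val x Finset.univ j).symm

/-- **Mode fugacity, `Fintype` form:** for positive weights `x : ι → ℝ` and every `M ≤ |ι|` there is a real `s`
with `e_j(x) e^{s j} ≤ e_M(x) e^{s M}` for all `j`, and then `∏ᵢ (1 + e^{s} xᵢ) ≤ (|ι| + 1) e_M(x) e^{sM}`. -/
def EsymmModeFugacity : Prop :=
  ∀ (ι : Type) [Fintype ι] [DecidableEq ι] (x : ι → ℝ) (M : ℕ), (∀ i, 0 < x i) → M ≤ Fintype.card ι →
    ∃ s : ℝ, (∀ j : ℕ, esymmW x j * Real.exp (s * j) ≤ esymmW x M * Real.exp (s * M)) ∧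
      (∏ i, (1 + Real.exp s * x i)) ≤ ((Fintype.card ι : ℝ) + 1) * (esymmW x M * Real.exp (s * M))

theorem esymmModeFugacity_holds : EsymmModeFugacity := by
  intro ι _ _ x M hx hM
  set X : Multiset ℝ := (Finset.univ : Finset ι).val.map x with hXdef
  have hcard : Multiset.card X = Fintype.card ι := by
    rw [hXdef, Multiset.card_map]
    rfl
  have hXpos : ∀ a ∈ X, 0 < a := by
    intro a ha
    rw [hXdef, Multiset.mem_map] at ha
    obtain ⟨i, _, rfl⟩ := ha
    exact hx i
  obtain ⟨t, ht, hmode⟩ := esymm_exists_modeFugacity X hXpos (M := M) (by rw [hcard]; exact hM)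
  refine ⟨Real.log t, ?_, ?_⟩
  · intro j
    have e1 : Real.exp (Real.log t * j) = t ^ j := by
      rw [mul_comm, Real.exp_nat_mul, Real.exp_log ht]
    have e2 : Real.exp (Real.log t * M) = t ^ M := by
      rw [mul_comm, Real.exp_nat_mul, Real.exp_log ht]
    rw [e1, e2, esymmW_eq_esymm, esymmW_eq_esymm]
    exact hmode j
  · have e2 : Real.exp (Real.log t * M) = t ^ M := by
      rw [mul_comm, Real.exp_nat_mul, Real.exp_log ht]
    rw [e2, Real.exp_log ht, esymmW_eq_esymm, ← hcard]
    have hprod : (∏ i, (1 + t * x i)) = (X.map fun a => 1 + t * a).prod := by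
      rw [hXdef, Multiset.map_map, Function.comp_def]
      exact (Finset.prod_map_val Finset.univ (fun i => 1 + t * x i)).symm
    rw [hprod]
    exact prod_one_add_mul_le_of_mode X hmode

/-! ## §E The off-arc Gaussian decay (the skeleton's `OffArcGaussianDecay`, verbatim) -/

/-- One mode: `|1 + u e^{iφ}|² = (1+u)² − 2u(1 − cos φ)` for real `u, φ`. -/
theorem normSq_one_add_mul_exp (u φ : ℝ) :
    ‖(1 : ℂ) + (u : ℂ) * Complex.exp (Complex.I * φ)‖ ^ 2 = (1 + u) ^ 2 - 2 * u * (1 - Real.cos φ) := by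
  have hre : ((1 : ℂ) + (u : ℂ) * Complex.exp (Complex.I * φ)).re = 1 + u * Real.cos φ := by
    simp [Complex.exp_re, Complex.exp_im]
  have him : ((1 : ℂ) + (u : ℂ) * Complex.exp (Complex.I * φ)).im = u * Real.sin φ := by
    simp [Complex.exp_re, Complex.exp_im]
  rw [← Complex.normSq_eq_norm_sq, Complex.normSq_apply, hre, him]
  have h := Real.sin_sq_add_cos_sq φ
  linear_combination u ^ 2 * h

/-- One mode: `|1 + u e^{iφ}| ≤ (1+u) · exp(−(1 − cos φ) u/(1+u)²)` for `u ≥ 0` (from `1 − y ≤ e^{−y}`). -/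
theorem norm_one_add_mul_exp_le (u φ : ℝ) (hu : 0 ≤ u) :
    ‖(1 : ℂ) + (u : ℂ) * Complex.exp (Complex.I * φ)‖ ≤
      (1 + u) * Real.exp (-((1 - Real.cos φ) * (u / (1 + u) ^ 2))) := by
  have h1u : 0 < 1 + u := by linarith
  set y : ℝ := (1 - Real.cos φ) * (u / (1 + u) ^ 2) with hy
  have hsq := normSq_one_add_mul_exp u φ
  have hkey : ‖(1 : ℂ) + (u : ℂ) * Complex.exp (Complex.I * φ)‖ ^ 2 ≤ ((1 + u) * Real.exp (-y)) ^ 2 := by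
    rw [hsq, mul_pow, ← Real.exp_nat_mul]
    have hexp : -(2 * y) + 1 ≤ Real.exp (-(2 * y)) := Real.add_one_le_exp _
    have e2 : ((2 : ℕ) : ℝ) * -y = -(2 * y) := by push_cast; ring
    rw [e2]
    have hid : (1 + u) ^ 2 * (-(2 * y) + 1) = (1 + u) ^ 2 - 2 * u * (1 - Real.cos φ) := by
      rw [hy]
      field_simp
      ring
    calc (1 + u) ^ 2 - 2 * u * (1 - Real.cos φ) = (1 + u) ^ 2 * (-(2 * y) + 1) := hid.symm
      _ ≤ (1 + u) ^ 2 * Real.exp (-(2 * y)) := mul_le_mul_of_nonneg_left hexp (by positivity)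
  exact le_of_pow_le_pow_left₀ two_ne_zero (by positivity) hkey

/-- [skeleton §3, verbatim] Off the arc the twisted product is Gaussian-small relative to the untwisted one. -/
def OffArcGaussianDecay : Prop :=
  ∀ (ι : Type) [Fintype ι] (u : ι → ℝ) (φ : ℝ), (∀ i, 0 < u i) →
    ‖∏ i, ((1 : ℂ) + (u i : ℂ) * Complex.exp (Complex.I * φ))‖ ≤
      (∏ i, (1 + u i)) * Real.exp (-((1 - Real.cos φ) * ∑ i, u i / (1 + u i) ^ 2))

/-- **The off-arc input holds.** -/
theorem offArcGaussianDecay_holds : OffArcGaussianDecay := by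
  intro ι _ u φ hu
  calc ‖∏ i, ((1 : ℂ) + (u i : ℂ) * Complex.exp (Complex.I * φ))‖
      = ∏ i, ‖(1 : ℂ) + (u i : ℂ) * Complex.exp (Complex.I * φ)‖ := norm_prod _ _
    _ ≤ ∏ i, ((1 + u i) * Real.exp (-((1 - Real.cos φ) * (u i / (1 + u i) ^ 2)))) :=
        Finset.prod_le_prod (fun i _ => norm_nonneg _) (fun i _ => norm_one_add_mul_exp_le (u i) φ (hu i).le)
    _ = (∏ i, (1 + u i)) * Real.exp (-((1 - Real.cos φ) * ∑ i, u i / (1 + u i) ^ 2)) := by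
        rw [Finset.prod_mul_distrib, ← Real.exp_sum, Finset.mul_sum, ← Finset.sum_neg_distrib]

/-! ## §F Fugacity pinning: ratio bounds `(n−k)·min·e_k ≤ (k+1)·e_{k+1} ≤ (n−k)·max·e_k` -/

/-- Upper ratio bound: if every weight is `≤ B`, then `(k+1) e_{k+1}(X) ≤ (|X| − k) B e_k(X)` (all `k`; for
`k ≥ |X|` both sides vanish or the right side is `≤ 0 = ` left side). -/
theorem succ_mul_esymm_succ_le (X : Multiset ℝ) {B : ℝ} (hX : ∀ a ∈ X, 0 ≤ a) (hB : ∀ a ∈ X, a ≤ B) :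
    ∀ k : ℕ, ((k : ℝ) + 1) * X.esymm (k + 1) ≤ ((Multiset.card X : ℝ) - k) * B * X.esymm k := by
  induction X using Multiset.induction with
  | empty =>
    intro k
    rw [esymm_eq_zero_of_card_lt 0 (by simp)]
    rcases Nat.eq_zero_or_pos k with rfl | hk
    · simp [esymm_zero_eq_one]
    · rw [esymm_eq_zero_of_card_lt 0 (by simpa using hk)]
      simp
  | cons x X ih =>
    intro k
    have hx : 0 ≤ x := hX x (Multiset.mem_cons_self x X)
    have hxB : x ≤ B := hB x (Multiset.mem_cons_self x X)
    have hX' : ∀ a ∈ X, 0 ≤ a := fun a ha => hX a (Multiset.mem_cons_of_mem ha)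
    have hB' : ∀ a ∈ X, a ≤ B := fun a ha => hB a (Multiset.mem_cons_of_mem ha)
    have hB0 : 0 ≤ B := hx.trans hxB
    rw [Multiset.card_cons, esymm_cons_succ]
    push_cast
    rcases k with _ | k
    · -- `k = 0`: `e_1(x ∷ X) = e_1(X) + x ≤ (n+1) B`
      have h := ih hX' hB' 0
      simp only [zero_add, one_mul, sub_zero, CharP.cast_eq_zero] at h ⊢
      rw [esymm_zero_eq_one] at h
      rw [esymm_zero_eq_one, esymm_zero_eq_one]
      nlinarith [h]
    · rw [esymm_cons_succ]
      have h1 := ih hX' hB' (k + 1)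
      have h0 := ih hX' hB' k
      have hek : 0 ≤ X.esymm k := esymm_nonneg X hX' k
      have hek1 : 0 ≤ X.esymm (k + 1) := esymm_nonneg X hX' (k + 1)
      push_cast at h1 h0 ⊢
      -- `(k+2) (e_{k+2} + x e_{k+1}) ≤ (n+1-(k+1)) B (e_{k+1} + x e_k)`:
      -- `(k+2) e_{k+2} ≤ (n-k-1) B e_{k+1}` (h1), `x (k+2) e_{k+1} = x[(k+1) e_{k+1} + e_{k+1}] ≤ x (n-k) B e_k + x e_{k+1}`
      -- (h0), and `x e_{k+1} ≤ B e_{k+1}`.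
      nlinarith [mul_le_mul_of_nonneg_left h0 hx, mul_le_mul_of_nonneg_right hxB hek1]

/-- Lower ratio bound: if every weight is `≥ b` (`b ≥ 0`), then `(|X| − k) b e_k(X) ≤ (k+1) e_{k+1}(X)`. -/
theorem sub_mul_esymm_le_succ_mul_esymm_succ (X : Multiset ℝ) {b : ℝ} (hb : 0 ≤ b) (hX : ∀ a ∈ X, b ≤ a) :
    ∀ k : ℕ, ((Multiset.card X : ℝ) - k) * b * X.esymm k ≤ ((k : ℝ) + 1) * X.esymm (k + 1) := by
  induction X using Multiset.induction with
  | empty =>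
    intro k
    rw [esymm_eq_zero_of_card_lt 0 (by simp : Multiset.card (0 : Multiset ℝ) < k + 1)]
    rcases Nat.eq_zero_or_pos k with rfl | hk
    · simp [esymm_zero_eq_one]
    · rw [esymm_eq_zero_of_card_lt 0 (by simpa using hk)]
      simp
  | cons x X ih =>
    intro k
    have hxb : b ≤ x := hX x (Multiset.mem_cons_self x X)
    have hx : 0 ≤ x := hb.trans hxb
    have hX' : ∀ a ∈ X, b ≤ a := fun a ha => hX a (Multiset.mem_cons_of_mem ha)
    have hX0' : ∀ a ∈ X, 0 ≤ a := fun a ha => hb.trans (hX' a ha)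
    have ih' := ih hX'
    rw [Multiset.card_cons, esymm_cons_succ]
    push_cast
    rcases k with _ | k
    · have h := ih' 0
      simp only [zero_add, one_mul, sub_zero, CharP.cast_eq_zero] at h ⊢
      rw [esymm_zero_eq_one] at h
      rw [esymm_zero_eq_one, esymm_zero_eq_one]
      nlinarith [h]
    · rw [esymm_cons_succ]
      have h1 := ih' (k + 1)
      have h0 := ih' k
      have hek : 0 ≤ X.esymm k := esymm_nonneg X hX0' k
      have hek1 : 0 ≤ X.esymm (k + 1) := esymm_nonneg X hX0' (k + 1)
      push_cast at h1 h0 ⊢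
      nlinarith [mul_le_mul_of_nonneg_left h0 hx, mul_le_mul_of_nonneg_right hxb hek1]

/-- **Fugacity pinning at a mode.** If `t > 0` makes `M` the mode of `j ↦ e_j(X) t^j` (positive weights in
`[b, B]`, `M < |X|`), then `(|X| − M)·b·t ≤ M + 1` and, if moreover `1 ≤ M`, `M ≤ (|X| − M + 1)·B·t`:
the fugacity is comparable to `M / (|X| − M)` within the factor `B/b` — for Boltzmann weights `e^{−βξ}`,
`|ξ| ≤ 4`, the chemical potential `β⁻¹ log t` lies in `[−4 − O(β⁻¹), 4 + O(β⁻¹)]` at any fixed filling fraction. -/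
theorem modeFugacity_pinned (X : Multiset ℝ) {b B t : ℝ} {M : ℕ} (hb : 0 < b) (hXb : ∀ a ∈ X, b ≤ a)
    (hXB : ∀ a ∈ X, a ≤ B) (ht : 0 < t) (hM : M < Multiset.card X)
    (hmode : ∀ j, X.esymm j * t ^ j ≤ X.esymm M * t ^ M) :
    ((Multiset.card X : ℝ) - M) * b * t ≤ (M : ℝ) + 1 ∧
      (1 ≤ M → (M : ℝ) ≤ ((Multiset.card X : ℝ) - M + 1) * B * t) := by
  have hX0 : ∀ a ∈ X, 0 ≤ a := fun a ha => hb.le.trans (hXb a ha)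
  have hXpos : ∀ a ∈ X, 0 < a := fun a ha => hb.trans_le (hXb a ha)
  have heM : 0 < X.esymm M := esymm_pos X hXpos hM.le
  constructor
  · -- from `e_{M+1} t^{M+1} ≤ e_M t^M`, i.e. `t e_{M+1} ≤ e_M`, and `(n−M) b e_M ≤ (M+1) e_{M+1}`
    have h1 := hmode (M + 1)
    rw [pow_succ] at h1
    have h1' : X.esymm (M + 1) * t ≤ X.esymm M := by
      have := h1
      have htM : 0 < t ^ M := pow_pos ht M
      nlinarith [this]
    have h2 := sub_mul_esymm_le_succ_mul_esymm_succ X hb.le hXb M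
    -- `(n−M) b t e_M ≤ (M+1) t e_{M+1} ≤ (M+1) e_M`
    have h3 : ((Multiset.card X : ℝ) - M) * b * t * X.esymm M ≤ ((M : ℝ) + 1) * X.esymm M := by
      nlinarith [mul_le_mul_of_nonneg_left h2 ht.le, mul_le_mul_of_nonneg_left h1' (by positivity : (0:ℝ) ≤ (M:ℝ) + 1)]
    exact le_of_mul_le_mul_right h3 heM
  · intro hM1
    -- from `e_{M−1} t^{M−1} ≤ e_M t^M`, i.e. `e_{M−1} ≤ t e_M`, and `M e_M ≤ (n−M+1) B e_{M−1}`
    obtain ⟨M', rfl⟩ : ∃ M', M = M' + 1 := ⟨M - 1, by omega⟩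
    have h1 := hmode M'
    rw [pow_succ] at h1
    have h1' : X.esymm M' ≤ X.esymm (M' + 1) * t := by
      have htM : 0 < t ^ M' := pow_pos ht M'
      nlinarith [h1]
    have h2 := succ_mul_esymm_succ_le X hX0 hXB M'
    have hB0 : 0 ≤ B := by
      obtain ⟨a, ha⟩ := Multiset.card_pos_iff_exists_mem.mp (by omega : 0 < Multiset.card X)
      exact (hX0 a ha).trans (hXB a ha)
    push_cast
    have hnM : (0:ℝ) ≤ (Multiset.card X : ℝ) - M' := by
      have : (M' : ℝ) + 1 < Multiset.card X := by exact_mod_cast hM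
      linarith
    have h3 : ((M' : ℝ) + 1) * X.esymm (M' + 1) ≤ ((Multiset.card X : ℝ) - (M' + 1) + 1) * B * t * X.esymm (M' + 1) := by
      have h4 := mul_le_mul_of_nonneg_left h1' (mul_nonneg hnM hB0)
      have hcast : ((Multiset.card X : ℝ) - (M' + 1) + 1) = (Multiset.card X : ℝ) - M' := by ring
      rw [hcast]
      nlinarith [h2, h4]
    exact le_of_mul_le_mul_right h3 heM

/-! ## §G The contour formula: `e_M(x) t^M` is the `M`-th Fourier coefficient of `φ ↦ ∏ᵢ (1 + t e^{iφ} xᵢ)` -/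

/-- **Coefficient extraction (any real fugacity `t`).**
`∫_{−π}^{π} e^{−iMφ} ∏ᵢ (1 + t xᵢ e^{iφ}) dφ = 2π · e_M(x) t^M` — the starting point of the arc/off-arc estimate
(orthogonality `Literature.Analysis.Toeplitz.integral_exp_int_mul_I` after expanding the product over subsets). -/
theorem esymmW_fourierCoeff {ι : Type} [Fintype ι] [DecidableEq ι] (x : ι → ℝ) (t : ℝ) (M : ℕ) :
    ∫ φ in (-π)..π, Complex.exp (-((M : ℂ) * φ * Complex.I)) *
        ∏ i, ((1 : ℂ) + ((t * x i : ℝ) : ℂ) * Complex.exp (φ * Complex.I))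
      = 2 * π * ((esymmW x M * t ^ M : ℝ) : ℂ) := by
  -- expand the product over subsets
  have hexp : ∀ φ : ℝ, ∏ i, ((1 : ℂ) + ((t * x i : ℝ) : ℂ) * Complex.exp (φ * Complex.I))
      = ∑ S ∈ (Finset.univ : Finset ι).powerset,
          ((t : ℂ) * Complex.exp (φ * Complex.I)) ^ S.card * ∏ i ∈ S, (x i : ℂ) := by
    intro φ
    rw [Finset.prod_one_add]
    refine Finset.sum_congr rfl fun S _ => ?_
    rw [← Finset.prod_const, ← Finset.prod_mul_distrib]
    refine Finset.prod_congr rfl fun i _ => ?_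
    push_cast
    ring
  simp_rw [hexp, Finset.mul_sum]
  -- each term is a constant times `e^{i(|S| − M)φ}`
  have hterm_fun : ∀ S : Finset ι, (fun φ : ℝ => Complex.exp (-((M : ℂ) * φ * Complex.I)) *
      (((t : ℂ) * Complex.exp (φ * Complex.I)) ^ S.card * ∏ i ∈ S, (x i : ℂ)))
      = fun φ : ℝ => ((t : ℂ) ^ S.card * ∏ i ∈ S, (x i : ℂ)) *
          Complex.exp ((((S.card : ℤ) - M : ℤ) : ℂ) * φ * Complex.I) := by
    intro S
    funext φ
    rw [mul_pow, ← Complex.exp_nat_mul]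
    have h2 : Complex.exp (-((M : ℂ) * φ * Complex.I)) * Complex.exp ((S.card : ℕ) * (φ * Complex.I))
        = Complex.exp ((((S.card : ℤ) - M : ℤ) : ℂ) * φ * Complex.I) := by
      rw [← Complex.exp_add]
      congr 1
      push_cast
      ring
    calc Complex.exp (-((M : ℂ) * φ * Complex.I)) *
          ((t : ℂ) ^ S.card * Complex.exp ((S.card : ℕ) * (φ * Complex.I)) * ∏ i ∈ S, (x i : ℂ))
        = (Complex.exp (-((M : ℂ) * φ * Complex.I)) * Complex.exp ((S.card : ℕ) * (φ * Complex.I))) *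
            ((t : ℂ) ^ S.card * ∏ i ∈ S, (x i : ℂ)) := by ring
      _ = _ := by rw [h2]; ring
  have hint : ∀ S ∈ (Finset.univ : Finset ι).powerset, IntervalIntegrable (fun φ : ℝ =>
      Complex.exp (-((M : ℂ) * φ * Complex.I)) *
        (((t : ℂ) * Complex.exp (φ * Complex.I)) ^ S.card * ∏ i ∈ S, (x i : ℂ))) MeasureTheory.volume (-π) π := by
    intro S _
    exact (Continuous.intervalIntegrable (by fun_prop) _ _)
  rw [intervalIntegral.integral_finsetSum hint]
  have hterm : ∀ S : Finset ι, ∫ φ in (-π)..π, Complex.exp (-((M : ℂ) * φ * Complex.I)) *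
      (((t : ℂ) * Complex.exp (φ * Complex.I)) ^ S.card * ∏ i ∈ S, (x i : ℂ))
      = if S.card = M then ((t : ℂ) ^ S.card * ∏ i ∈ S, (x i : ℂ)) * (2 * π) else 0 := by
    intro S
    rw [hterm_fun S, intervalIntegral.integral_const_mul, Literature.Analysis.Toeplitz.integral_exp_int_mul_I]
    by_cases h : S.card = M
    · rw [if_pos (by omega : ((S.card : ℤ) - M : ℤ) = 0), if_pos h]
    · rw [if_neg (by omega : ¬ ((S.card : ℤ) - M : ℤ) = 0), if_neg h, mul_zero]
  rw [Finset.sum_congr rfl (fun S _ => hterm S), ← Finset.sum_filter, ← Finset.powersetCard_eq_filter]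
  -- on `powersetCard M`, `|S| = M`
  rw [Finset.sum_congr rfl (fun S hS => by rw [(Finset.mem_powersetCard.1 hS).2]), ← Finset.sum_mul,
    ← Finset.mul_sum]
  unfold esymmW
  push_cast
  ring

/-! ## §H The one-line logarithm is strip-analytic (the skeleton v2's `FreeBandLogStrip`, verbatim) -/

/-- `|sinh y| ≤ 2|y|` for `|y| ≤ 1`. -/
theorem abs_sinh_le_two_mul_abs {y : ℝ} (hy : |y| ≤ 1) : |Real.sinh y| ≤ 2 * |y| := by
  rw [Real.sinh_eq]
  have h1 := Real.abs_exp_sub_one_le hy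
  have h2 := Real.abs_exp_sub_one_le (x := -y) (by rwa [abs_neg])
  rw [abs_neg] at h2
  have : Real.exp y - Real.exp (-y) = (Real.exp y - 1) - (Real.exp (-y) - 1) := by ring
  rw [this, abs_div, abs_two]
  calc |(Real.exp y - 1) - (Real.exp (-y) - 1)| / 2
      ≤ (|Real.exp y - 1| + |Real.exp (-y) - 1|) / 2 := by gcongr; exact abs_sub _ _
    _ ≤ (2 * |y| + 2 * |y|) / 2 := by gcongr
    _ = 2 * |y| := by ring

/-- `cosh y ≤ 3` for `|y| ≤ 1`. -/
theorem cosh_le_three {y : ℝ} (hy : |y| ≤ 1) : Real.cosh y ≤ 3 := by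
  rw [Real.cosh_eq]
  have h1 := (abs_le.1 (Real.abs_exp_sub_one_le hy)).2
  have h2 := (abs_le.1 (Real.abs_exp_sub_one_le (x := -y) (by rwa [abs_neg]))).2
  rw [abs_neg] at h2
  linarith

/-- Real part of `cos z`. -/
theorem cos_re_eq (z : ℂ) : (Complex.cos z).re = Real.cos z.re * Real.cosh z.im := by
  rw [Complex.cos_eq]; simp [Complex.cos_ofReal_re, Complex.cosh_ofReal_re]

/-- Imaginary part of `cos z`. -/
theorem cos_im_eq (z : ℂ) : (Complex.cos z).im = -(Real.sin z.re * Real.sinh z.im) := by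
  rw [Complex.cos_eq]; simp [Complex.sin_ofReal_re, Complex.sinh_ofReal_re]

/-- [skeleton v2 §3, verbatim] For `β > 0` there are a strip half-width `a > 0` and a bound `B` such that for every
log-fugacity `s ∈ [−4β − 1, 4β + 1]`, every arc angle `|φ| ≤ π/2` and every transverse momentum `p₂`, the one-line logarithm
`v(z) = Log(1 + exp(s + iφ + 2β cos z + 2β cos p₂))` is `2π`-periodic, complex-differentiable on `|Im z| < a`, bounded by
`B` there, and exponentiates back to the factor on the real line. -/
def FreeBandLogStrip : Prop :=
  ∀ β : ℝ, 0 < β → ∃ a : ℝ, 0 < a ∧ ∃ B : ℝ, 0 ≤ B ∧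
    ∀ s : ℝ, -4 * β - 1 ≤ s → s ≤ 4 * β + 1 → ∀ φ : ℝ, |φ| ≤ π / 2 → ∀ p₂ : ℝ,
      let v : ℂ → ℂ := fun z =>
        Complex.log (1 + Complex.exp ((s : ℂ) + (φ : ℂ) * Complex.I + 2 * β * Complex.cos z + 2 * β * Real.cos p₂))
      (∀ z : ℂ, v (z + 2 * π) = v z) ∧
      DifferentiableOn ℂ v {z : ℂ | |z.im| < a} ∧
      (∀ z : ℂ, |z.im| < a → ‖v z‖ ≤ B) ∧
      (∀ p₁ : ℝ, Complex.exp (v p₁) =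
        1 + Complex.exp ((s : ℂ) + (φ : ℂ) * Complex.I + 2 * β * Real.cos p₁ + 2 * β * Real.cos p₂))

/-- **The strip input holds**, with `a = min 1 (π/(24β))` and `B = e^{12β+1} + 1 + π`: on the strip the exponent has
imaginary part in `[−2π/3, 2π/3]` (`|φ| ≤ π/2`, `|Im(2β cos z)| ≤ 4βa ≤ π/6`), so `w = e^{g}` has `Re w ≥ −‖w‖/2`,
`1 + w` lies in the slit plane with `‖1 + w‖ ≥ 1/2`, and `‖w‖ ≤ e^{12β+1}`. -/
theorem freeBandLogStrip_holds : FreeBandLogStrip := by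
  intro β hβ
  have ha_pos : 0 < min 1 (π / (24 * β)) := lt_min one_pos (by positivity)
  have ha1 : min 1 (π / (24 * β)) ≤ 1 := min_le_left _ _
  have ha2 : 4 * β * min 1 (π / (24 * β)) ≤ π / 6 := by
    calc 4 * β * min 1 (π / (24 * β)) ≤ 4 * β * (π / (24 * β)) := by gcongr; exact min_le_right _ _
      _ = π / 6 := by field_simp; ring
  refine ⟨min 1 (π / (24 * β)), ha_pos, Real.exp (12 * β + 1) + 1 + π, by positivity, ?_⟩
  intro s hs1 hs2 φ hφ p₂
  dsimp only
  -- the exponent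
  set g : ℂ → ℂ := fun z =>
    (s : ℂ) + (φ : ℂ) * Complex.I + 2 * β * Complex.cos z + 2 * β * Real.cos p₂ with hg
  have hgz : ∀ z : ℂ, (s : ℂ) + (φ : ℂ) * Complex.I + 2 * β * Complex.cos z + 2 * β * Real.cos p₂ = g z :=
    fun z => rfl
  simp_rw [hgz]
  -- key facts on the strip
  have key : ∀ z : ℂ, |z.im| < min 1 (π / (24 * β)) →
      (1 + Complex.exp (g z)) ∈ Complex.slitPlane ∧ 1 / 2 ≤ ‖1 + Complex.exp (g z)‖ ∧
        ‖Complex.exp (g z)‖ ≤ Real.exp (12 * β + 1) := by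
    intro z hz
    have hy1 : |z.im| ≤ 1 := hz.le.trans ha1
    have hgim : (g z).im = φ - 2 * β * (Real.sin z.re * Real.sinh z.im) := by
      simp [hg, cos_im_eq]; ring
    have hgre : (g z).re = s + 2 * β * (Real.cos z.re * Real.cosh z.im) + 2 * β * Real.cos p₂ := by
      simp [hg, cos_re_eq]
    have hsinh : |Real.sinh z.im| ≤ 2 * |z.im| := abs_sinh_le_two_mul_abs hy1
    have hss : |Real.sin z.re * Real.sinh z.im| ≤ 2 * min 1 (π / (24 * β)) := by
      rw [abs_mul]
      calc |Real.sin z.re| * |Real.sinh z.im| ≤ 1 * (2 * |z.im|) := by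
            gcongr
            · exact Real.abs_sin_le_one _
        _ ≤ 2 * min 1 (π / (24 * β)) := by linarith [hz.le]
    have hψ : |(g z).im| ≤ π / 2 + π / 6 := by
      rw [hgim]
      have h2 : |2 * β * (Real.sin z.re * Real.sinh z.im)| ≤ 4 * β * min 1 (π / (24 * β)) := by
        rw [abs_mul, abs_of_pos (by positivity : (0:ℝ) < 2 * β)]
        nlinarith [hss, hβ]
      calc |φ - 2 * β * (Real.sin z.re * Real.sinh z.im)|
          ≤ |φ| + |2 * β * (Real.sin z.re * Real.sinh z.im)| := abs_sub _ _
        _ ≤ π / 2 + π / 6 := by linarith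
    have hcos : -(1 / 2 : ℝ) ≤ Real.cos (g z).im := by
      rw [← Real.cos_abs]
      have hle : |(g z).im| ≤ π / 6 + π / 2 := by linarith
      have := Real.cos_le_cos_of_nonneg_of_le_pi (abs_nonneg _) (by linarith [Real.pi_pos]) hle
      rw [Real.cos_add_pi_div_two, Real.sin_pi_div_six] at this
      linarith
    have hρpos : 0 < Real.exp (g z).re := Real.exp_pos _
    have hw_re : (Complex.exp (g z)).re = Real.exp (g z).re * Real.cos (g z).im := Complex.exp_re _
    have hw_im : (Complex.exp (g z)).im = Real.exp (g z).re * Real.sin (g z).im := Complex.exp_im _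
    have hw_norm : ‖Complex.exp (g z)‖ = Real.exp (g z).re := Complex.norm_exp _
    refine ⟨?_, ?_, ?_⟩
    · rw [Complex.mem_slitPlane_iff]
      by_cases hsin : Real.sin (g z).im = 0
      · left
        have hlt1 : -π < (g z).im := by have := (abs_le.1 hψ).1; linarith [Real.pi_pos]
        have hlt2 : (g z).im < π := by have := (abs_le.1 hψ).2; linarith [Real.pi_pos]
        have h0 : (g z).im = 0 := (Real.sin_eq_zero_iff_of_lt_of_lt hlt1 hlt2).1 hsin
        rw [Complex.add_re, Complex.one_re, hw_re, h0, Real.cos_zero, mul_one]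
        linarith
      · right
        rw [Complex.add_im, Complex.one_im, hw_im, zero_add]
        exact mul_ne_zero hρpos.ne' hsin
    · have hsq : (3 : ℝ) / 4 ≤ ‖1 + Complex.exp (g z)‖ ^ 2 := by
        rw [Complex.sq_norm, Complex.normSq_apply, Complex.add_re, Complex.add_im, Complex.one_re, Complex.one_im,
          hw_re, hw_im, zero_add]
        have hsc : Real.sin (g z).im ^ 2 + Real.cos (g z).im ^ 2 = 1 := Real.sin_sq_add_cos_sq _
        nlinarith [hcos, hρpos, hsc, sq_nonneg (Real.exp (g z).re - 1 / 2)]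
      nlinarith [norm_nonneg (1 + Complex.exp (g z)), hsq]
    · rw [hw_norm]
      apply Real.exp_le_exp.2
      rw [hgre]
      have hcosh : Real.cosh z.im ≤ 3 := cosh_le_three hy1
      have h1 : Real.cos z.re * Real.cosh z.im ≤ 3 := by
        calc Real.cos z.re * Real.cosh z.im ≤ |Real.cos z.re * Real.cosh z.im| := le_abs_self _
          _ = |Real.cos z.re| * Real.cosh z.im := by rw [abs_mul, abs_of_pos (Real.cosh_pos _)]
          _ ≤ 1 * 3 := by
              gcongr
              · exact Real.abs_cos_le_one _
          _ = 3 := one_mul _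
      have h2 : Real.cos p₂ ≤ 1 := Real.cos_le_one _
      nlinarith [hβ, h1, h2, hs2]
  refine ⟨?_, ?_, ?_, ?_⟩
  · -- periodicity
    intro z
    simp only [hg, Complex.cos_add_two_pi]
  · -- differentiability on the strip
    intro z hz
    have hz' : |z.im| < min 1 (π / (24 * β)) := hz
    apply DifferentiableAt.differentiableWithinAt
    have hd : DifferentiableAt ℂ (fun z => 1 + Complex.exp (g z)) z := by
      simp only [hg]
      fun_prop
    exact hd.clog (key z hz').1
  · -- the bound
    intro z hz
    obtain ⟨hslit, hlow, hup⟩ := key z hz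
    have hne : 1 + Complex.exp (g z) ≠ 0 := Complex.slitPlane_ne_zero hslit
    have hpos : 0 < ‖1 + Complex.exp (g z)‖ := norm_pos_iff.2 hne
    have hre : |(Complex.log (1 + Complex.exp (g z))).re| ≤ Real.exp (12 * β + 1) + 1 := by
      rw [Complex.log_re, abs_le]
      constructor
      · -- lower: log x = -log x⁻¹ ≥ -(x⁻¹ - 1) ≥ -1
        have hinv : Real.log (‖1 + Complex.exp (g z)‖)⁻¹ ≤ (‖1 + Complex.exp (g z)‖)⁻¹ - 1 :=
          Real.log_le_sub_one_of_pos (inv_pos.2 hpos)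
        rw [Real.log_inv] at hinv
        have hinv2 : (‖1 + Complex.exp (g z)‖)⁻¹ ≤ 2 := by
          rw [inv_le_comm₀ hpos (by norm_num)]; linarith
        linarith [Real.exp_pos (12 * β + 1)]
      · have h1 : Real.log ‖1 + Complex.exp (g z)‖ ≤ ‖1 + Complex.exp (g z)‖ - 1 := Real.log_le_sub_one_of_pos hpos
        have h2 : ‖1 + Complex.exp (g z)‖ ≤ 1 + ‖Complex.exp (g z)‖ := by
          calc ‖1 + Complex.exp (g z)‖ ≤ ‖(1 : ℂ)‖ + ‖Complex.exp (g z)‖ := norm_add_le _ _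
            _ = 1 + ‖Complex.exp (g z)‖ := by rw [norm_one]
        linarith
    have him : |(Complex.log (1 + Complex.exp (g z))).im| ≤ π := by
      rw [Complex.log_im]; exact Complex.abs_arg_le_pi _
    calc ‖Complex.log (1 + Complex.exp (g z))‖
        ≤ |(Complex.log (1 + Complex.exp (g z))).re| + |(Complex.log (1 + Complex.exp (g z))).im| :=
          Complex.norm_le_abs_re_add_abs_im _
      _ ≤ Real.exp (12 * β + 1) + 1 + π := by linarith
  · -- exponentiating back on the real line
    intro p₁
    have h0 : |((p₁ : ℂ)).im| < min 1 (π / (24 * β)) := by simpa using ha_pos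
    rw [Complex.exp_log (Complex.slitPlane_ne_zero (key p₁ h0).1)]
    simp only [hg, Complex.ofReal_cos]

end Summit.Ventures.CertifiedManyBodySolver.Cruxes.ThermalStiffnessCeilingU8b10_le_1o8.FreeGasArcInputs
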